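import Summits.CriticalPhenomena.CardyFormulaZ2.Theses.CardySegmentWeakRSW
import Summits.CriticalPhenomena.CardyFormulaZ2.Theorems.CardySelfDualSegmentSegmentClosed
import HarnessLib

/-!
# SKELVET reconstruction of the registered BC3 skeleton of `ClosedOfWeakBoxCrossing`
(stmt-CriticalPhenomena-18421, route `CardySegmentWeakRSW`, skeleton sha e6a41610…)

The registered file (`pub_birth_18421.lean`, planner folder / gate evidence store) is not
readable from this seat.  The two registered stub signatures are reproduced VERBATIM
(`ledger workitem stubs stmt-CriticalPhenomena-18421`) over the reconstructed local vocabulary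
`PB` (pre-sheared box data — literally the hypothesis shape of the floor's `stub_confinement`),
`WBCAt` (the crux's first hypothesis at one parameter) and `UMAt` (its second hypothesis at one
parameter), and the assembly `ClosedOfWeakBoxCrossing_of` is re-proved for them (kernel-checked,
sorries only in the two stubs), following the floor proof `segmentClosed_of_stubs`.
-/

noncomputable section

open Set Filter Metric MeasureTheory Complex
open scoped Topology
open UpperHalfPlane (upperHalfPlaneSet)
open Literature.Probability.RandomPlanarGeometry Literature.Probability.Percolation
open Literature.Probability.LatticeModels Literature.Barriers.CriticalPhenomena
open Summit.CriticalPhenomena.CardyFormulaZ2.Cruxes.SegmentClosed.Sketch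

namespace Summit.CriticalPhenomena.CardyFormulaZ2.Cruxes.ClosedOfWeakBoxCrossing.SkelVet

/-- Pre-sheared Box data at parameter `t` and inverse shear `β ∈ ℍ`: the crude `M_t`-crossing
probabilities of every pre-sheared box `φ_β((0,w)×(0,h))` tend to the Cardy value of the box
(the hypothesis shape of the floor's `stub_confinement`). -/
def PB (t : unitInterval) (β : ℂ) (hβ : 0 < β.im) : Prop :=
  ∀ (w h : ℝ) (hw : 0 < w) (hh : 0 < h)
    (φ : ConformalEquiv upperHalfPlaneSet (rectQuad 0 w 0 h hw hh).carrier) (x : Fin 4 → ℝ),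
    (rectQuad 0 w 0 h hw hh).IsUniformizing φ x →
    Tendsto (cornerCrossingProb t ((rectQuad 0 w 0 h hw hh).map (shearHomeomorph β hβ.ne')))
      (𝓝[>] 0) (𝓝 (Literature.Probability.RandomPlanarGeometry.cardyFunction (crossRatio x)))

/-- Weak box crossing AT `t₀` (the crux's first hypothesis, one parameter). -/
def WBCAt (t₀ : unitInterval) : Prop :=
  ∃ c > 0, ∀ δ₀ : ℝ, 0 < δ₀ → ∃ δ : ℝ, 0 < δ ∧ δ < δ₀ ∧
    cornerCrossingProb t₀ (rectQuad 0 2 0 1 two_pos one_pos) δ ≤ 1 - c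

/-- Uniform marginality AT `t₀` (the crux's second hypothesis, one parameter). -/
def UMAt (t₀ : unitInterval) : Prop :=
  ∀ (R : ConformalRectangle) (ε : ℝ), 0 < ε → ∃ η > 0, ∀ t : unitInterval, dist t t₀ < η →
    ∀ δ : ℝ, 0 < δ → |cornerCrossingProb t R δ - cornerCrossingProb t₀ R δ| < ε

/-- Registered stub 1 (signature verbatim). -/
theorem stub_escapeDichotomy (t : ℕ → unitInterval) (β : ℕ → ℂ) (hβ : ∀ n, 0 < (β n).im) (hPB : ∀ n, PB (t n) (β n) (hβ n)) : (∃ K : Set ℂ, IsCompact K ∧ K ⊆ {z | 0 < z.im} ∧ ∃ᶠ n in atTop, β n ∈ K) ∨ (∃ s : ℝ, |s| = 1 ∧ ∃ ψ : ℕ → ℕ, StrictMono ψ ∧ Tendsto (fun n => (β (ψ n)).im) atTop atTop ∧ Tendsto (fun n => (β (ψ n)).re / (β (ψ n)).im) atTop (𝓝 s)) := by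
  sorry

/-- Registered stub 2 (signature verbatim). -/
theorem stub_noNeedleEscape (t₀ : unitInterval) (hW : WBCAt t₀) (hU : UMAt t₀) (t : ℕ → unitInterval) (ht : Tendsto t atTop (𝓝 t₀)) (β : ℕ → ℂ) (hβ : ∀ n, 0 < (β n).im) (hPB : ∀ n, PB (t n) (β n) (hβ n)) (s : ℝ) (hs : |s| = 1) (him : Tendsto (fun n => (β n).im) atTop atTop) (hre : Tendsto (fun n => (β n).re / (β n).im) atTop (𝓝 s)) : False := by
  sorry

/-- The assembly: the two registered stubs give the crux (real proof term; the floor's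
`pullback_constant`, `invParam_im_pos`, `stub_identification` are tree theorems). -/
theorem ClosedOfWeakBoxCrossing_of :
    Summit.CriticalPhenomena.CardyFormulaZ2.Theses.CardySegmentWeakRSW.ClosedOfWeakBoxCrossing := by
  intro hW hU
  set CM : unitInterval → ℂ → Prop := fun t α => ∀ (R R' : ConformalRectangle)
    (φ : ConformalEquiv upperHalfPlaneSet R.carrier) (x : Fin 4 → ℝ),
    R.carrier = moduliShear α '' R'.carrier → (∀ i, R.pt i = moduliShear α (R'.pt i)) →
    R.IsUniformizing φ x → Tendsto (cornerCrossingProb t R') (𝓝[>] 0)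
      (𝓝 (Literature.Probability.RandomPlanarGeometry.cardyFunction (crossRatio x))) with hCM
  change IsClosed {t | ∃ α : ℂ, 0 < α.im ∧ CM t α}
  have hW' : ∀ t₀ : unitInterval, WBCAt t₀ := hW
  have hU' : ∀ t₀ : unitInterval, UMAt t₀ := hU
  refine IsSeqClosed.isClosed fun ts t₀ hts hlim => ?_
  choose αs hαs using hts
  set βs : ℕ → ℂ := fun n => (I - ((αs n).re : ℂ)) / ((αs n).im : ℂ) with hβs_def
  have hβs : ∀ n, 0 < (βs n).im := fun n => invParam_im_pos (hαs n).1
  have hPB : ∀ n, PB (ts n) (βs n) (hβs n) := fun n w h hw hh φ x hx =>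
    pullback_constant (hαs n).1 (hαs n).2 (hβs n) w h hw hh φ x hx
  have hinv : ∀ n, αs n = (I - ((βs n).re : ℂ)) / ((βs n).im : ℂ) := by
    intro n
    have him : (αs n).im ≠ 0 := (hαs n).1.ne'
    have him' : ((αs n).im : ℂ) ≠ 0 := ofReal_ne_zero.2 him
    apply Complex.ext
    · simp [hβs_def, Complex.div_ofReal_re, Complex.div_ofReal_im]
      field_simp
    · simp [hβs_def, Complex.div_ofReal_re, Complex.div_ofReal_im]
  rcases stub_escapeDichotomy ts βs hβs hPB with ⟨K, hKc, hKH, hfreq⟩ | ⟨s, hs, ψ, hψ, him, hre⟩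
  · -- compact branch: a subsequence in `K`, a convergent sub-subsequence, identification
    obtain ⟨ψ, hψ, hψK⟩ := extraction_of_frequently_atTop hfreq
    obtain ⟨β₀, hβ₀K, θ, hθ, hβlim⟩ := hKc.tendsto_subseq hψK
    have hβ₀ : 0 < β₀.im := hKH hβ₀K
    set α₀ : ℂ := (I - (β₀.re : ℂ)) / (β₀.im : ℂ) with hα₀_def
    have hα₀ : 0 < α₀.im := invParam_im_pos hβ₀
    have hαlim : Tendsto (αs ∘ (ψ ∘ θ)) atTop (𝓝 α₀) := by
      have hcont : ContinuousAt (fun β : ℂ => (I - (β.re : ℂ)) / (β.im : ℂ)) β₀ := by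
        have h1 : ContinuousAt (fun β : ℂ => (I - (β.re : ℂ))) β₀ := by fun_prop
        have h2 : ContinuousAt (fun β : ℂ => (β.im : ℂ)) β₀ := by fun_prop
        exact h1.div h2 (ofReal_ne_zero.2 hβ₀.ne')
      have h := hcont.tendsto.comp hβlim
      refine (tendsto_congr fun k => ?_).1 h
      simp only [Function.comp_apply]
      exact (hinv (ψ (θ k))).symm
    refine ⟨α₀, hα₀, ?_⟩
    intro R R' φ x hc hp hu
    exact stub_identification cornerCrossingProb (ts ∘ (ψ ∘ θ)) t₀ (αs ∘ (ψ ∘ θ)) α₀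
      (hlim.comp (hψ.comp hθ).tendsto_atTop) hαlim (fun n => (hαs (ψ (θ n))).1) hα₀ (hU' t₀)
      (fun n => (hαs (ψ (θ n))).2) R R' φ x hc hp hu
  · -- needle branch: excluded at the limit parameter
    exact (stub_noNeedleEscape t₀ (hW' t₀) (hU' t₀) (ts ∘ ψ) (hlim.comp hψ.tendsto_atTop)
      (βs ∘ ψ) (fun n => hβs (ψ n)) (fun n => hPB (ψ n)) s hs him hre).elim

end Summit.CriticalPhenomena.CardyFormulaZ2.Cruxes.ClosedOfWeakBoxCrossing.SkelVet

end
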